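import Summits.RiemannHypothesis.RiemannHypothesis.Theses.WeilParity
import Summits.RiemannHypothesis.RiemannHypothesis.Theses.WeilGroundState
import Summits.RiemannHypothesis.RiemannHypothesis.Theorems.WeilParityEvenWinsBeyondArchFrontier67
import Summits.RiemannHypothesis.RiemannHypothesis.Theorems.WeilWindowFlowDiniLeakageCalibration
import Literature.NumberTheory.LFunctions.WeilGroundEnergyParitySplit
import HarnessLib

/-!
# Grönwall transport of the PARITY ORDER from the PROVED frontier `a ≤ 2/3` — typed targets
# (pub-rhpf, transport-1, leaf G1.22 'TRANSPORT', PF-persistence side; RH-free glue; def-free)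

**mechanism/rigidity campaign; no RH claims.**  Companion text:
`run/shared/lean/pub/pub-rhpf/pub-rhpf-transport-1/TRANSPORT.md` §5 (T-P).

The Perron–Frobenius persistence statement of the cell in ground-energy language is the strict parity
order `ε_ev(a) < ε_od(a)` (`weilEvenGroundEnergy a < weilOddGroundEnergy a`): the bottom of the windowed Weil
form is attained in the even sector and only there.  PROVED in tree (RH-free, certified): the order on every
window `0 < a ≤ 2/3` (`EvenWinsBeyondArch.weilEvenGroundEnergy_lt_weilOddGroundEnergy_of_le_two_thirds`),
continuity of both sector bottoms on `(0, ∞)` (`Theorems.stub_sectorContinuity`), and the reductions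
`NoParityCrossing ↔ (no tie beyond 2/3)`, `GroundStateSimpleEven ↔ (no tie beyond 2/3)`
(`…Frontier67`).  What remains of the route items `WeilParity.NoParityCrossing` (stmt-18085),
`WeilGroundState.GroundStateSimpleEven` (stmt-1526) and `WeilParity.EvenWinsBeyondArch` (stmt-15432) is
therefore a TRANSPORT problem for the splitting `Q(a) := ε_od(a) − ε_ev(a)` from the seed `Q(2/3) > 0`.

This file records, sorry-free and without new definitions, the two transport inputs that close them:

* `splitting_pos_of_diniLeakageFrom` / `noParityCrossing_of_splittingLeakage` /
  `groundStateSimpleEven_of_splittingLeakage` / `evenWinsBeyondArch_of_splittingLeakage` — a DINI LEAKAGE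
  bound for `Q` with a locally bounded rate on `[2/3, ∞)` ("the parity gap never closes at a finite relative
  rate"; the multiplicative fence `WeilWindowFlowDiniLeakage.mul_exp_le_of_dini`) gives the strict order at
  every window, hence the three items BY NAME;
* `noParityCrossing_of_archSplittingTransport` — the INTEGRATED sharp form suggested by the a-ladder DATA
  (TRANSPORT.md Table L1: `−Q′/Q = 8π e^{2a} − m⁻(a)`, `m⁻ ∈ [13.5, 23.5]` on `a ∈ [0.35, 2.1]`):
  `Q(a) ≥ c · Q(2/3) · exp(−4π (e^{2a} − e^{4/3}))` for `a ≥ 2/3` with some constant `c > 0`.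

Labels: every hypothesis named `hD` / `h` below is an INPUT (CONJ for ζ; DATA-consistent on the served ladder);
everything else is PROVED tree material.  The inputs are violated by the served off-line controls exactly
where their bottom parity flips (TRANSPORT.md Table L5) — they are RH-bearing (route WeilParity's crux
`OffLineParityDetection`), not known to be RH-equivalent.
-/

noncomputable section

set_option linter.dupNamespace false  -- D-0017 nested layout: `RiemannHypothesis.RiemannHypothesis`

namespace Summit.RiemannHypothesis.RiemannHypothesis.Theorems.PfPersistenceParityTransport

open Set Filter Topology
open _root_.Literature.NumberTheory.LFunctions
open _root_.Summit.RiemannHypothesis.RiemannHypothesis.Theses.WeilParity (NoParityCrossing EvenWinsBeyondArch)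
open _root_.Summit.RiemannHypothesis.RiemannHypothesis.Theses.WeilGroundState (GroundStateSimpleEven)
open _root_.Summit.RiemannHypothesis.RiemannHypothesis.Theorems (stub_sectorContinuity)
open _root_.Summit.RiemannHypothesis.RiemannHypothesis.Theorems.EvenWinsBeyondArch
  (weilEvenGroundEnergy_lt_weilOddGroundEnergy_of_le_two_thirds noParityCrossing_of_beyond_two_thirds
    groundStateSimpleEven_iff_noParityCrossingBeyond_two_thirds evenWinsBeyondArch_of_noTie_beyond_two_thirds)
open _root_.Summit.RiemannHypothesis.RiemannHypothesis.Theorems.WeilWindowFlowDiniLeakage (mul_exp_le_of_dini)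

/-! ## 1. The splitting and its seed -/

/-- The splitting `Q = ε_od − ε_ev` is continuous on every `[b, c] ⊂ (0, ∞)` (landed sector continuity). [folklore] -/
theorem continuousOn_splitting_Icc {b c : ℝ} (hb : 0 < b) :
    ContinuousOn (fun x ↦ weilOddGroundEnergy x - weilEvenGroundEnergy x) (Icc b c) := by
  have hsub : Icc b c ⊆ Ioi (0 : ℝ) := fun x hx ↦ lt_of_lt_of_le hb hx.1
  exact (stub_sectorContinuity.2.mono hsub).sub (stub_sectorContinuity.1.mono hsub)

/-- The PROVED seed at the frontier: `Q(2/3) > 0`. [folklore] -/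
theorem splitting_pos_two_thirds :
    0 < weilOddGroundEnergy (2 / 3) - weilEvenGroundEnergy (2 / 3) :=
  sub_pos.2 (weilEvenGroundEnergy_lt_weilOddGroundEnergy_of_le_two_thirds (by norm_num) le_rfl)

/-! ## 2. Dini leakage of the splitting from an anchor ⟹ strict parity order beyond it -/

/-- **Grönwall transport of the parity order from an anchor.** If `ε_ev(a₁) < ε_od(a₁)` at some `a₁ > 0` and on
every `[a₁, A]` the splitting `Q = ε_od − ε_ev` obeys a Dini leakage bound with some rate `K`
(`Q(x) − Q(x+h) ≤ h (K Q(x) + η)` for small `h`, in the `η/δ/h` form of `WeilWindowFlow.DiniLeakage`), then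
`ε_ev(a) < ε_od(a)` for every `a ≥ a₁`. [folklore] -/
theorem splitting_pos_of_diniLeakageFrom {a₁ : ℝ} (ha₁ : 0 < a₁)
    (hanchor : weilEvenGroundEnergy a₁ < weilOddGroundEnergy a₁)
    (hD : ∀ A : ℝ, a₁ ≤ A → ∃ K : ℝ, ∀ x ∈ Ico a₁ A, ∀ η δ : ℝ, 0 < η → 0 < δ →
      ∃ h : ℝ, 0 < h ∧ h < δ ∧
        (weilOddGroundEnergy x - weilEvenGroundEnergy x) -
            (weilOddGroundEnergy (x + h) - weilEvenGroundEnergy (x + h)) ≤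
          h * (K * (weilOddGroundEnergy x - weilEvenGroundEnergy x) + η)) :
    ∀ a : ℝ, a₁ ≤ a → weilEvenGroundEnergy a < weilOddGroundEnergy a := by
  intro a ha
  obtain ⟨K, hK⟩ := hD a ha
  have hpos : 0 < weilOddGroundEnergy a₁ - weilEvenGroundEnergy a₁ := sub_pos.2 hanchor
  have key := mul_exp_le_of_dini (f := fun x ↦ weilOddGroundEnergy x - weilEvenGroundEnergy x)
    (continuousOn_splitting_Icc (c := a) ha₁) hpos hK a ⟨ha, le_rfl⟩
  have : 0 < (weilOddGroundEnergy a₁ - weilEvenGroundEnergy a₁) * Real.exp (-(K * (a - a₁))) :=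
    mul_pos hpos (Real.exp_pos _)
  exact sub_pos.1 (this.trans_le key)

/-- **Dini leakage of the splitting beyond the PROVED frontier `2/3` ⟹ the strict order at every window
`a > 2/3`.** [folklore] -/
theorem lt_beyond_two_thirds_of_splittingLeakage
    (hD : ∀ A : ℝ, 2 / 3 ≤ A → ∃ K : ℝ, ∀ x ∈ Ico (2 / 3 : ℝ) A, ∀ η δ : ℝ, 0 < η → 0 < δ →
      ∃ h : ℝ, 0 < h ∧ h < δ ∧
        (weilOddGroundEnergy x - weilEvenGroundEnergy x) -
            (weilOddGroundEnergy (x + h) - weilEvenGroundEnergy (x + h)) ≤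
          h * (K * (weilOddGroundEnergy x - weilEvenGroundEnergy x) + η)) :
    ∀ a : ℝ, 2 / 3 < a → weilEvenGroundEnergy a < weilOddGroundEnergy a :=
  fun a ha ↦ splitting_pos_of_diniLeakageFrom (by norm_num)
    (weilEvenGroundEnergy_lt_weilOddGroundEnergy_of_le_two_thirds (by norm_num) le_rfl) hD a ha.le

/-- **Item stmt-RiemannHypothesis-18085 from the splitting leakage.** [folklore] -/
theorem noParityCrossing_of_splittingLeakage
    (hD : ∀ A : ℝ, 2 / 3 ≤ A → ∃ K : ℝ, ∀ x ∈ Ico (2 / 3 : ℝ) A, ∀ η δ : ℝ, 0 < η → 0 < δ →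
      ∃ h : ℝ, 0 < h ∧ h < δ ∧
        (weilOddGroundEnergy x - weilEvenGroundEnergy x) -
            (weilOddGroundEnergy (x + h) - weilEvenGroundEnergy (x + h)) ≤
          h * (K * (weilOddGroundEnergy x - weilEvenGroundEnergy x) + η)) :
    NoParityCrossing :=
  noParityCrossing_of_beyond_two_thirds fun a ha ↦ ne_of_lt (lt_beyond_two_thirds_of_splittingLeakage hD a ha)

/-- **Item stmt-RiemannHypothesis-1526 (`GroundStateSimpleEven`) from the splitting leakage.** [folklore] -/
theorem groundStateSimpleEven_of_splittingLeakage
    (hD : ∀ A : ℝ, 2 / 3 ≤ A → ∃ K : ℝ, ∀ x ∈ Ico (2 / 3 : ℝ) A, ∀ η δ : ℝ, 0 < η → 0 < δ →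
      ∃ h : ℝ, 0 < h ∧ h < δ ∧
        (weilOddGroundEnergy x - weilEvenGroundEnergy x) -
            (weilOddGroundEnergy (x + h) - weilEvenGroundEnergy (x + h)) ≤
          h * (K * (weilOddGroundEnergy x - weilEvenGroundEnergy x) + η)) :
    GroundStateSimpleEven :=
  groundStateSimpleEven_iff_noParityCrossingBeyond_two_thirds.2
    fun a ha ↦ ne_of_lt (lt_beyond_two_thirds_of_splittingLeakage hD a ha)

/-- **Item stmt-RiemannHypothesis-15432 (`EvenWinsBeyondArch`) from the splitting leakage.** [folklore] -/
theorem evenWinsBeyondArch_of_splittingLeakage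
    (hD : ∀ A : ℝ, 2 / 3 ≤ A → ∃ K : ℝ, ∀ x ∈ Ico (2 / 3 : ℝ) A, ∀ η δ : ℝ, 0 < η → 0 < δ →
      ∃ h : ℝ, 0 < h ∧ h < δ ∧
        (weilOddGroundEnergy x - weilEvenGroundEnergy x) -
            (weilOddGroundEnergy (x + h) - weilEvenGroundEnergy (x + h)) ≤
          h * (K * (weilOddGroundEnergy x - weilEvenGroundEnergy x) + η)) :
    EvenWinsBeyondArch :=
  evenWinsBeyondArch_of_noTie_beyond_two_thirds
    fun a ha ↦ ne_of_lt (lt_beyond_two_thirds_of_splittingLeakage hD a ha)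

/-! ## 3. The integrated sharp form (archimedean rate for the splitting) -/

/-- **Integrated archimedean transport of the splitting ⟹ `NoParityCrossing`.** If for some constant
`c > 0` and every `a ≥ 2/3`, `Q(a) ≥ c · Q(2/3) · exp(−4π (e^{2a} − e^{4/3}))` (`Q = ε_od − ε_ev`; DATA: the
splitting of ζ decays at the relative rate `8π e^{2a} − m⁻(a)` with `m⁻ > 13` on the served ladder), then the
parity order is strict at every window `a > 2/3`, so items 18085 / 1526 / 15432 follow. [folklore] -/
theorem noParityCrossing_of_archSplittingTransport {c : ℝ} (hc : 0 < c)
    (h : ∀ a : ℝ, 2 / 3 ≤ a →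
      c * (weilOddGroundEnergy (2 / 3) - weilEvenGroundEnergy (2 / 3)) *
          Real.exp (-(4 * Real.pi * (Real.exp (2 * a) - Real.exp (2 * (2 / 3))))) ≤
        weilOddGroundEnergy a - weilEvenGroundEnergy a) :
    NoParityCrossing ∧ GroundStateSimpleEven ∧ EvenWinsBeyondArch := by
  have hlt : ∀ a : ℝ, 2 / 3 < a → weilEvenGroundEnergy a < weilOddGroundEnergy a := fun a ha ↦
    sub_pos.1 ((mul_pos (mul_pos hc splitting_pos_two_thirds) (Real.exp_pos _)).trans_le (h a ha.le))
  exact ⟨noParityCrossing_of_beyond_two_thirds fun a ha ↦ ne_of_lt (hlt a ha),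
    groundStateSimpleEven_iff_noParityCrossingBeyond_two_thirds.2 fun a ha ↦ ne_of_lt (hlt a ha),
    evenWinsBeyondArch_of_noTie_beyond_two_thirds fun a ha ↦ ne_of_lt (hlt a ha)⟩

end Summit.RiemannHypothesis.RiemannHypothesis.Theorems.PfPersistenceParityTransport

end
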